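import Literature.AnabelianGeometry.AbsoluteAnabelian.AbsTopIII.LogFrobeniusObservableProofs
import Literature.AnabelianGeometry.AbsoluteAnabelian.AbsTopIII.FrobeniusPictureMLFCores
import Mathlib.CategoryTheory.SingleObj
import Mathlib.CategoryTheory.Groupoid
import Mathlib.CategoryTheory.PUnit
import Mathlib.Data.ZMod.Basic
import HarnessLib

/-!
# [AbsTopIII] Cor. 3.6 (iii)/(iv)/(v) as SCHEMATA over abstract input data (FACT-LIST F-0355, F-0356,
# F-0357): universal closures REFUTED at explicit toy data; the printed instance forms are theorems

S. Mochizuki, *Topics in absolute anabelian geometry III: global reconstruction algorithms*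
[MochizukiAbsTopIII2015]; kurims manuscript pages (`paper:url-5493eb38cbb7`): Corollary 3.6 (iii) p. 80
(proof p. 81), (iv) pp. 80–81, (v) pp. 80, 82.

PROOF-ONLY negative-knowledge file (no definition, no instance) next to the trunk file
`AbsTopIII/FrobeniusPictureMLF.lean` (seats abc-iut-L4-t2/t5), abc-iut cell seat abc-iut-f-080 (block F,
FACT-LIST rows **F-0355** `LogFrobeniusData.IncompatibleStmt`, **F-0356** `LogFrobeniusData.LogPinned`,
**F-0357** `LogFrobeniusData.NexusRigidStmt`; class `preparatory`, kernel_closedness `parametrised`).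

All three declarations are PREDICATES on an ABSTRACT input datum `Δ : LogFrobeniusData` (the six
categories and the functors `log`, `λ^×`, `λ^{×pf}`, `ι_log`, `ι_×`, … of Def. 3.1 as free binders; `LogPinned`
has a second binder, a family of homotopies `H` on `𝒟_{≤3}`).  Print asserts Cor. 3.6 ONLY for the
MLF-Galois data of Def. 3.1, and for those data the tree HOLDS the instance / conditional forms:

* (iv) `IncompatibleStmt`: `LogFrobeniusData.incompatibleStmt_of_lemma34` (from the Lemma-3.4 property,
  abc-iut-L4-t5) and, Lemma 3.4 DISCHARGED at the cell's model, `AbsTopIII.TFModel.incompatibleStmt_model`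
  (`FrobeniusPictureMLFModel.lean`); restricted form `AbsTopIII.BiAnabelianSetting.incompatibleStmt_restrict`.
* (iii) `LogPinned`: the family `𝔖_log` of the proof of (iii) p. 81 — abc-iut-L4-t10's `AbsTopIII.hLogFamily`
  — IS pinned: `logPinned_hLogFamily` below (every datum of holomorphic orientation), and for EVERY datum
  some family is pinned (`exists_logPinned`, from abc-iut-w4-d095's `observableLogStmt`).
* (v) `NexusRigidStmt`: `LogFrobeniusData.nexusRigidStmt_of` / `nexusRigidStmt_of_isEquivalence` (from
  id-rigidity, abc-iut-L4-t5), `AbsTopIII.MonoAnabelianLogFrobeniusData.nexusRigidStmt`, and Prop. 3.2 (iv)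
  DISCHARGED at the model: `AbsTopIII.TFModel.nexusRigidStmt_model`.

This file supplies the kernel objects saying that the UNIVERSAL closures over all abstract data are
FALSE: at the one-object DISCRETE datum (all six categories `Discrete PUnit`, all functors identities)
the total boundary set with `eqToHom` homotopies is a family containing the would-be core isomorphisms
AND the `𝔖_log` generators, so `IncompatibleStmt` FAILS (`exists_not_incompatibleStmt`); the EMPTY family
of homotopies is never pinned (`exists_not_logPinned`, every `Δ`); at the one-object GROUPOID datum of
`ℤ/2` (all functors identities) the category `𝒳` at the nexus `□` carries the non-trivial central
automorphism of `𝟭_𝒳`, so it is not id-rigid and `NexusRigidStmt` FAILS (`exists_not_nexusRigidStmt`).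
So F-0355/F-0356/F-0357 are admissible ONLY in their instance forms (FACT-LIST class «universal-closure
REFUTED; instance forms PROVED / conditional»), never as closed schemata — in particular none of the three
may appear as a `∀ Δ`-binder of a conditional certificate (it would make the certificate vacuous).
Refereed pre-IUT material; refuted-as-schema is not a defect of print, whose statements are the
instances; nothing here bears on [IUTchIII] Cor. 3.12 or takes a side.
-/

namespace Literature.AnabelianGeometry.AbsoluteAnabelian.LogFrobeniusData

open _root_.CategoryTheory _root_.Quiver DiagramOfCategories

universe u

/-! ### F-0356 `LogPinned`: the printed family IS pinned; the empty family is not -/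

/-- **F-0356, instance form PROVED (Cor. 3.6 (iii), proof p. 81)**: for every input datum of holomorphic
orientation (`ι_× = ι : λ^× → λ^{×pf}`) the family of homotopies `𝔖_log` constructed by abc-iut-L4-t10
(`AbsTopIII.hLogFamily`: one whiskered `ι_{log,⋎}` or `ι_×` per pair of type (1)/(2)) CONTAINS the basic
type-(1)/(2) pairs with exactly `ι_{log,⋎}`, `ι_×` as homotopies — "`ι_{log,⋎}` (respectively, `ι_×`)
determine(s) the homotopies for pairs of paths of type (1) (respectively, (2))".  (This is the pinned
conjunct of t10's `observableLogStmt_of_inl`, recorded for the family BY NAME.)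
[cite: MochizukiAbsTopIII2015, Corollary 3.6 (iii) p.81] -/
theorem logPinned_hLogFamily (Δ : LogFrobeniusData.{u}) (ι : Δ.lamTimes ⟶ Δ.lamPf)
    (hι : Δ.ιtimes = Sum.inl ι) :
    Literature.AnabelianGeometry.AbsoluteAnabelian.LogFrobeniusData.LogPinned Δ
      (AbsTopIII.hLogFamily Δ ι) := by
  unfold LogFrobeniusData.LogPinned
  rw [hι]
  refine ⟨⟨⟨rfl, AbsTopIII.lvNexus_ne_lvObs, Or.inr ⟨rfl, Or.inl rfl⟩⟩, fun x e₁ e₂ => ?_⟩,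
    fun n => ⟨⟨rfl, AbsTopIII.lvRow1_ne_lvObs _, Or.inr ⟨rfl, Or.inr rfl⟩⟩, fun x e₁ e₂ => ?_⟩⟩
  · rw [AbsTopIII.hLogFamily_η, AbsTopIII.hLogEta_timesPair]
    simp only [NatTrans.comp_app, eqToHom_app, Functor.whiskerLeft_app, eqToHom_refl, Category.comp_id]
    rfl
  · rw [AbsTopIII.hLogFamily_η, AbsTopIII.hLogEta_logPair]
    simp only [NatTrans.comp_app, eqToHom_app, Functor.whiskerLeft_app, eqToHom_refl, Category.comp_id]
    rfl

/-- **F-0356, instance form for EVERY datum (Cor. 3.6 (iii) p. 80 / Cor. 4.5 (iii) p. 109)**: every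
abstract input datum (either orientation of `ι_×`) admits a family of homotopies on `𝒟_{≤3}` pinned by
`ι_{log,⋎}`, `ι_×` — the pinned conjunct of abc-iut-w4-d095's unconditional `observableLogStmt`.
[cite: MochizukiAbsTopIII2015, Corollary 3.6 (iii) p.80] -/
theorem exists_logPinned (Δ : LogFrobeniusData.{u}) :
    ∃ H : Δ.sub3.HomotopyFamily,
      Literature.AnabelianGeometry.AbsoluteAnabelian.LogFrobeniusData.LogPinned Δ H := by
  obtain ⟨H, -, -, h⟩ := Δ.observableLogStmt
  exact ⟨H, h⟩

/-- **F-0356 as a schema in `H` is false for EVERY datum**: the EMPTY family of homotopies on `𝒟_{≤3}`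
(empty boundary set — saturated, no homotopies) contains no type-(1) pair, so it is not pinned.  (Print
pins THE family `𝔖_log` of the proof of (iii), cf. `logPinned_hLogFamily`; an arbitrary family is not
claimed to be pinned.) [cite: MochizukiAbsTopIII2015, Corollary 3.6 (iii) p.81] -/
theorem exists_not_logPinned (Δ : LogFrobeniusData.{u}) :
    ∃ H : Δ.sub3.HomotopyFamily,
      ¬ Literature.AnabelianGeometry.AbsoluteAnabelian.LogFrobeniusData.LogPinned Δ H := by
  let H : Δ.sub3.HomotopyFamily :=
    { E := fun _ _ _ _ => False
      isSaturated :=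
        { refl_left := fun _ _ _ _ h => h.elim
          refl_right := fun _ _ _ _ h => h.elim
          trans := fun _ _ _ _ _ h _ => h.elim
          precomp := fun _ _ _ _ _ h _ => h.elim
          postcomp := fun _ _ _ _ _ h _ => h.elim }
      η := fun _ _ _ _ h => h.elim
      η_refl := fun _ _ _ h => h.elim
      η_trans := fun _ _ _ _ _ h _ => h.elim
      η_whisker := fun _ _ _ _ _ _ h _ _ => h.elim }
  refine ⟨H, fun h => ?_⟩
  obtain ⟨h₁, -⟩ := h.2 0
  exact h₁

/-! ### F-0355 `IncompatibleStmt`: the universal closure fails at the one-object discrete datum -/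

/-- **F-0355 as a schema is false at an explicit datum (Cor. 3.6 (iv) pp. 80–81)**: at the abstract
log-Frobenius input datum all of whose categories are the one-object discrete category (all functors
identities, `ι_log`, `ι_×` identities) the typed first incompatibility FAILS: the TOTAL boundary set on
`𝒟_{≤3}` (every co-verticial pair; homotopies the unique natural transformations) is a family of homotopies
containing an isomorphism for every would-be core pair `([id_{⋎+1}], [id_⋎]∘[log])` AND the `𝔖_log`
generators with homotopies `ι_{log,⋎}`, `ι_×`.  Print's (iv) concerns the MLF-Galois data, where the
Lemma-3.4 property excludes such a family (`incompatibleStmt_of_lemma34`, `TFModel.incompatibleStmt_model`);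
the toy datum violates Lemma 3.4. [cite: MochizukiAbsTopIII2015, Corollary 3.6 (iv) p.81] -/
theorem exists_not_incompatibleStmt :
    ∃ Δ : LogFrobeniusData.{0},
      ¬ Literature.AnabelianGeometry.AbsoluteAnabelian.LogFrobeniusData.IncompatibleStmt Δ := by
  -- the one-object discrete datum
  let Δ : LogFrobeniusData.{0} :=
    { X₁ := Discrete PUnit.{1}, X := Discrete PUnit.{1}, toNexus := 𝟭 _, N := Discrete PUnit.{1},
      E := Discrete PUnit.{1}, A := Discrete PUnit.{1},
      log := 𝟭 _, logIsoId := Iso.refl _,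
      lamTimes := 𝟭 _, lamPf := 𝟭 _,
      ιlog := (Functor.rightUnitor (𝟭 (Discrete PUnit.{1}) ⋙ 𝟭 (Discrete PUnit.{1}))).hom,
      ιtimes := Sum.inl (𝟙 _),
      XtoE := 𝟭 _, NtoE := 𝟭 _,
      lamTimes_NtoE := Functor.punit_ext' _ _, lamPf_NtoE := Functor.punit_ext' _ _,
      κ := 𝟭 _, AtoE := 𝟭 _, κ_equiv := inferInstance, κ_inv := Functor.punitExt _ _,
      φ := 𝟭 _, φ_equiv := inferInstance, η := Functor.punitExt _ _ }
  -- functors into, and natural transformations between functors into, the one-object discrete category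
  have hP₁ : ∀ {C : Type} [Category.{0} C] (F G : C ⥤ Discrete PUnit.{1}), F = G :=
    fun F G => Functor.punit_ext' F G
  have hP₂ : ∀ {C : Type} [Category.{0} C] (F G : C ⥤ Discrete PUnit.{1}) (α β : F ⟶ G), α = β :=
    fun F G α β => NatTrans.ext (funext fun _ => Subsingleton.elim _ _)
  have hP₃ : ∀ (A B : Discrete PUnit.{1}) (f g : A ⟶ B), f = g := fun _ _ _ _ => Subsingleton.elim _ _
  -- every vertex category of `𝒟_{≤3}` of this datum IS that category
  have heq : ∀ (a b : logObsShape.{0}.Vertex) (F G : Δ.sub3.obj a ⥤ Δ.sub3.obj b), F = G := by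
    rintro a (⟨⟨_ | _ | _ | _ | _ | _⟩, _⟩ | _) <;> exact fun F G => hP₁ F G
  have hsub : ∀ (a b : logObsShape.{0}.Vertex) (F G : Δ.sub3.obj a ⥤ Δ.sub3.obj b) (α β : F ⟶ G),
      α = β := by
    rintro a (⟨⟨_ | _ | _ | _ | _ | _⟩, _⟩ | _) <;> exact fun F G α β => hP₂ F G α β
  have hN : ∀ (A B : Δ.sub3.obj lvObs.{0}) (f g : A ⟶ B), f = g := fun A B f g => hP₃ A B f g
  -- the TOTAL family: every co-verticial pair, homotopy = the unique natural transformation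
  let K : Δ.sub3.HomotopyFamily :=
    { E := fun _ _ _ _ => True
      isSaturated :=
        { refl_left := fun _ _ _ _ _ => trivial
          refl_right := fun _ _ _ _ _ => trivial
          trans := fun _ _ _ _ _ _ _ => trivial
          precomp := fun _ _ _ _ _ _ _ => trivial
          postcomp := fun _ _ _ _ _ _ _ => trivial }
      η := fun a b p q _ => eqToHom (heq a b _ _)
      η_refl := fun _ _ _ _ => hsub _ _ _ _ _ _
      η_trans := fun _ _ _ _ _ _ _ => hsub _ _ _ _ _ _
      η_whisker := fun _ _ _ _ _ _ _ _ _ => hsub _ _ _ _ _ _ }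
  refine ⟨Δ, fun h => h ⟨K, fun n => ⟨trivial, ?_⟩, ?_⟩⟩
  · -- the would-be core homotopy `ζ₀` is an isomorphism
    exact ⟨⟨eqToHom (heq _ _ _ _), hsub _ _ _ _ _ _, hsub _ _ _ _ _ _⟩⟩
  · -- `K` contains the `𝔖_log` generators with homotopies `ι_×`, `ι_{log,⋎}` (all morphisms of `𝒩` agree)
    unfold LogFrobeniusData.LogPinned
    rw [show Δ.ιtimes = Sum.inl (𝟙 _) from rfl]
    exact ⟨⟨trivial, fun x e₁ e₂ => hN _ _ _ _⟩, fun n => ⟨trivial, fun x e₁ e₂ => hN _ _ _ _⟩⟩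

/-- **FACT-LIST F-0355, universal closure REFUTED** (fully quantified form, universe `0`): it is NOT
the case that every abstract log-Frobenius input datum satisfies the typed first incompatibility of
Cor. 3.6 (iv).  The admissible forms of the row are `incompatibleStmt_of_lemma34` (conditional on the
Lemma-3.4 property) and the instance `AbsTopIII.TFModel.incompatibleStmt_model` at the MLF-Galois model.
[cite: MochizukiAbsTopIII2015, Corollary 3.6 (iv) pp.80–81] -/
theorem not_forall_incompatibleStmt :
    ¬ ∀ Δ : LogFrobeniusData.{0},
      Literature.AnabelianGeometry.AbsoluteAnabelian.LogFrobeniusData.IncompatibleStmt Δ := by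
  obtain ⟨Δ, h⟩ := exists_not_incompatibleStmt
  exact fun H => h (H Δ)

/-- **FACT-LIST F-0356, universal closure REFUTED** (fully quantified form, universe `0`): it is NOT
the case that every family of homotopies on `𝒟_{≤3}` of every abstract datum is pinned by `ι_{log,⋎}`,
`ι_×` (the empty family is not).  The admissible forms are `logPinned_hLogFamily` / `exists_logPinned`.
[cite: MochizukiAbsTopIII2015, Corollary 3.6 (iii) p.81] -/
theorem not_forall_logPinned :
    ¬ ∀ (Δ : LogFrobeniusData.{0}) (H : Δ.sub3.HomotopyFamily),
      Literature.AnabelianGeometry.AbsoluteAnabelian.LogFrobeniusData.LogPinned Δ H := by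
  obtain ⟨Δ, -⟩ := exists_not_incompatibleStmt
  obtain ⟨H, hH⟩ := exists_not_logPinned Δ
  exact fun h => hH (h Δ H)

/-! ### F-0357 `NexusRigidStmt`: the universal closure fails at the one-object groupoid of `ℤ/2` -/

/-- **F-0357 as a schema is false at an explicit datum (Cor. 3.6 (v) pp. 80, 82)**: at the abstract
log-Frobenius input datum all of whose categories are the one-object groupoid of `G = ℤ/2` (all functors
identities, `η`'s the unitors) the typed "`□` is a nexus and `𝒟` is totally `□`-rigid" FAILS: total
`□`-rigidity contains the id-rigidity of the category `𝒳` at `□` (Def. 3.5 (vi)), but the non-trivial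
central element `g` is a non-identity automorphism of `𝟭_𝒳`.  Print's (v) concerns `𝒳 = 𝒞^{MLF-sB}_T`,
id-rigid by Prop. 3.2 (iv) (`nexusRigidStmt_of`, `TFModel.nexusRigidStmt_model`).
[cite: MochizukiAbsTopIII2015, Corollary 3.6 (v) p.82] -/
theorem exists_not_nexusRigidStmt :
    ∃ Δ : LogFrobeniusData.{0},
      ¬ Literature.AnabelianGeometry.AbsoluteAnabelian.LogFrobeniusData.NexusRigidStmt Δ := by
  let G2 : Type := Multiplicative (ZMod 2)
  -- the one-object groupoid datum (as in abc-iut-w5-d061's `exists_not_telecoreStmt`)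
  let Δ : LogFrobeniusData.{0} :=
    { X₁ := CategoryTheory.SingleObj G2, X := CategoryTheory.SingleObj G2, toNexus := 𝟭 _,
      N := CategoryTheory.SingleObj G2, E := CategoryTheory.SingleObj G2,
      A := CategoryTheory.SingleObj G2, log := 𝟭 _, logIsoId := Iso.refl _,
      lamTimes := 𝟭 _, lamPf := 𝟭 _,
      ιlog := (Functor.rightUnitor
        (𝟭 (CategoryTheory.SingleObj G2) ⋙ 𝟭 (CategoryTheory.SingleObj G2))).hom,
      ιtimes := Sum.inl (𝟙 _),
      XtoE := 𝟭 _, NtoE := 𝟭 _, lamTimes_NtoE := Functor.comp_id _, lamPf_NtoE := Functor.comp_id _,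
      κ := 𝟭 _, AtoE := 𝟭 _, κ_equiv := inferInstance, κ_inv := Functor.rightUnitor _,
      φ := 𝟭 _, φ_equiv := inferInstance, η := Functor.rightUnitor _ ≪≫ Functor.rightUnitor _ }
  -- the non-trivial central automorphism `g` of the unique object
  let g : (CategoryTheory.SingleObj.star G2) ≅ (CategoryTheory.SingleObj.star G2) :=
    (Groupoid.isoEquivHom (CategoryTheory.SingleObj.star G2) (CategoryTheory.SingleObj.star G2)).symm
      (Multiplicative.ofAdd (1 : ZMod 2))
  have hg : g.hom = Multiplicative.ofAdd (1 : ZMod 2) := rfl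
  -- `g` as an automorphism of the identity functor of `𝒳`
  let α : 𝟭 (CategoryTheory.SingleObj G2) ≅ 𝟭 (CategoryTheory.SingleObj G2) :=
    NatIso.ofComponents (fun _ => g) (fun {X Y} f => by
      simp only [Functor.id_map, hg]
      exact mul_comm (Multiplicative.ofAdd (1 : ZMod 2) : G2) (f : G2))
  refine ⟨Δ, fun h => ?_⟩
  -- total `□`-rigidity gives the id-rigidity of `𝒳` at the vertex `□` of the pre-nexus portion
  have hX : IsIdRigid (CategoryTheory.SingleObj G2) :=
    (Δ.nexusRigidStmt_iff.1 h).1 ⟨LFVertex.nexus, Or.inr rfl⟩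
  have key := congrArg (fun β : 𝟭 (CategoryTheory.SingleObj G2) ≅ 𝟭 (CategoryTheory.SingleObj G2) =>
    β.hom.app (CategoryTheory.SingleObj.star G2)) (hX α)
  simp only [α, NatIso.ofComponents_hom_app, Iso.refl_hom, NatTrans.id_app, Functor.id_obj, hg] at key
  -- `key : g = 𝟙 ⋆`, i.e. `1 = 0` in `ℤ/2`
  have k3 : (Multiplicative.ofAdd (1 : ZMod 2) : G2) = 1 := by
    rw [← CategoryTheory.SingleObj.id_as_one G2 (CategoryTheory.SingleObj.star G2)]; exact key
  exact absurd (Multiplicative.ofAdd.injective (k3.trans ofAdd_zero.symm)) (by decide)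

/-- **FACT-LIST F-0357, universal closure REFUTED** (fully quantified form, universe `0`): it is NOT
the case that for every abstract log-Frobenius input datum "`□` is a nexus and `𝒟` is totally `□`-rigid".
The admissible forms of the row are `nexusRigidStmt_of` / `nexusRigidStmt_of_isEquivalence` (from the
id-rigidity of `𝒳`, Prop. 3.2 (iv)), `AbsTopIII.MonoAnabelianLogFrobeniusData.nexusRigidStmt` and the
instance `AbsTopIII.TFModel.nexusRigidStmt_model` at the MLF-Galois model.
[cite: MochizukiAbsTopIII2015, Corollary 3.6 (v) pp.80–82] -/
theorem not_forall_nexusRigidStmt :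
    ¬ ∀ Δ : LogFrobeniusData.{0},
      Literature.AnabelianGeometry.AbsoluteAnabelian.LogFrobeniusData.NexusRigidStmt Δ := by
  obtain ⟨Δ, h⟩ := exists_not_nexusRigidStmt
  exact fun H => h (H Δ)

end Literature.AnabelianGeometry.AbsoluteAnabelian.LogFrobeniusData
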